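import Literature.Analysis.Complex.WeierstrassPreparation
import Literature.Geometry.Kaehler.RiemannExtensionCodimTwo
import Literature.Geometry.Kaehler.AnalyticSetComponentsProofs
import Literature.Geometry.Kaehler.AnalyticSetRegular
import HarnessLib

/-!
# The order of a holomorphic function along a smooth hypersurface

Support for GAGA for line bundles (`AlgebraicGeometry/HodgeTheory/GAGALineBundles*`; J.-P. Serre,
*Géométrie algébrique et géométrie analytique* (1956), n° 20 Remarque 1: the divisor of a
meromorphic section of a holomorphic line bundle). P. Griffiths, J. Harris, *Principles of
Algebraic Geometry* (1978), Ch. 1 §1, "Divisors and line bundles" (pp. 130–131): for `V ⊂ M` an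
irreducible analytic hypersurface with local defining function `f` near `p` and `g` holomorphic
near `p`, the order `ord_{V,p}(g)` is the largest `a` with `g = f^a h` in `𝒪_p`, and "it is
independent of `p`" along `V` (relatively prime elements of `𝒪_p` stay relatively prime nearby).
This file PROVES the smooth-point form of these statements, which is all the divisor of a section
needs at the generic points of the components of its zero set:

* `Literature.Analysis.Complex.SCV.exists_eq_pow_mul_of_forall_eq_zero_iff` — **local normal form
  in a polydisc** (E. M. Chirka, *Complex Analytic Sets* (1989), §1.1–1.2, via the tree's Weierstrass
  preparation theorem `WeierstrassData.weierstrass_preparation`): if `F`, `G` are holomorphic near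
  `(z₀, c) ∈ E × ℂ`, have the same zeros, and the slice `G (z₀, ·)` has a simple zero at `c`, then
  `F = G ^ k · u` near `(z₀, c)` with `u` holomorphic and zero-free (both Weierstrass polynomials
  are powers of the same linear factor `w - τ(z')`);
* `exists_eventuallyEq_pow_mul_of_mfderiv_ne_zero` — the same on a complex manifold: `h`, `w`
  holomorphic near `m`, `w m = 0`, `dw(m) ≠ 0`, `{h = 0} = {w = 0}` near `m` ⟹ `h = w ^ k · v` near
  `m` with `v` holomorphic, `v m ≠ 0`;
* `orderAlong h w m` — the order of `h` along `{w = 0}` at `m` (the largest `k` with `h = w ^ k · v`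
  near `m`, `v` continuous at `m`), with `orderAlong_eq_of_eventuallyEq` (**uniqueness of the
  exponent**: a normal form with `v m ≠ 0` computes it, whenever `w` takes non-zero values
  arbitrarily near `m`) — whence invariance under multiplication of `h` and `w` by units and local
  constancy along the hypersurface (Griffiths–Harris, loc. cit.);
* `codim_le_one_of_isRegularPointOfCodim_of_eq_setOf` — **a hypersurface has codimension `≤ 1` at
  each of its regular points**: a regular point of codimension `≥ 2` of `{h = 0}` is removable for
  `1/h` (the tree's second Riemann extension theorem, `RiemannExtensionCodimTwo`), absurd.

Everything is proved; no definitions beyond `orderAlong`, no named facts.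

## References

* [GriffithsHarrisPrinciples1978] P. Griffiths, J. Harris, Principles of Algebraic Geometry, Wiley
  (1978), Ch. 1 §1, pp. 130–131.
* [Chirka1989] E. M. Chirka, Complex Analytic Sets, Kluwer (1989), §1.1 Thm. (Weierstrass
  preparation), §1.2.
* [FritzscheGrauert2002] K. Fritzsche, H. Grauert, From Holomorphic Functions to Complex Manifolds,
  GTM 213 (2002), Ch. III Thm. 6.12.
* [SerreGAGA1956] J.-P. Serre, Géométrie algébrique et géométrie analytique, Ann. Inst. Fourier 6
  (1956), n° 20 Remarque 1.
-/

noncomputable section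

open Complex Metric Set Filter Function
open scoped Topology Manifold

/-! ### The local normal form in a polydisc (Weierstrass preparation) -/

namespace Literature.Analysis.Complex
namespace SCV

variable {E : Type*} [NormedAddCommGroup E] [NormedSpace ℂ E]

omit [NormedAddCommGroup E] [NormedSpace ℂ E] in
/-- The Weierstrass polynomial of a slice all of whose roots in the disc sit at one point `τ` is
`(w - τ) ^ k`. [folklore] -/
theorem weierstrassFun_eq_pow_of_eq_replicate {f : E × ℂ → ℂ} {c : ℂ} {r : ℝ} {z' : E} {k : ℕ}
    {τ : ℂ} (h : sliceRoots f c r z' = Multiset.replicate k τ) (w : ℂ) :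
    weierstrassFun f c r (z', w) = (w - τ) ^ k := by
  simp [weierstrassFun, h, Multiset.map_replicate, Multiset.prod_replicate]

/-- **Local normal form of a holomorphic function along a smooth hypersurface, polydisc form.**
Let `F`, `G` be holomorphic on an open `Ω ⊆ E × ℂ` containing `(z₀, c)`, with the same zeros in
`Ω`, and suppose the slice `G (z₀, ·)` has a simple zero at `c`. Then there are `k : ℕ`, an open
neighbourhood `U ⊆ Ω` of `(z₀, c)` and `u` holomorphic and zero-free on `U` with `F = G ^ k · u` on
`U`. Proof (Chirka §1.1–1.2): by the Weierstrass preparation theorem `G = W_G · u_G`,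
`F = W_F · u_F` near `(z₀, c)` with zero-free units; the slice `G (z', ·)` has exactly one zero
`τ(z')` in the disc (the number of zeros is locally constant and is `1` at `z₀`), and the zeros of
`F (z', ·)` are zeros of `G (z', ·)`, so `W_G = w - τ(z')` and `W_F = (w - τ(z')) ^ k`, whence
`F = G ^ k · (u_F / u_G ^ k)`. [cite: Chirka1989, §1.1 Thm. (p. 3) and §1.2]
[cite: GriffithsHarrisPrinciples1978, Ch. 1 §1 (p. 130)] -/
theorem exists_eq_pow_mul_of_forall_eq_zero_iff {F G : E × ℂ → ℂ} {Ω : Set (E × ℂ)}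
    (hΩ : IsOpen Ω) (hF : DifferentiableOn ℂ F Ω) (hG : DifferentiableOn ℂ G Ω) {z₀ : E} {c : ℂ}
    (h₀ : (z₀, c) ∈ Ω) (hG0 : G (z₀, c) = 0) (hG' : deriv (fun w ↦ G (z₀, w)) c ≠ 0)
    (hZ : ∀ x ∈ Ω, F x = 0 ↔ G x = 0) :
    ∃ (k : ℕ) (U : Set (E × ℂ)) (u : E × ℂ → ℂ), IsOpen U ∧ (z₀, c) ∈ U ∧ U ⊆ Ω ∧
      DifferentiableOn ℂ u U ∧ (∀ x ∈ U, u x ≠ 0) ∧ ∀ x ∈ U, F x = G x ^ k * u x := by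
  classical
  -- the slice of `G` at `z₀`: analytic, simple zero at `c`, not identically zero
  set g₀ : ℂ → ℂ := fun w ↦ G (z₀, w) with hg₀
  have hslice : IsOpen {w : ℂ | (z₀, w) ∈ Ω} := hΩ.preimage (by fun_prop)
  have hg₀d : DifferentiableOn ℂ g₀ {w : ℂ | (z₀, w) ∈ Ω} :=
    hG.comp (by fun_prop) fun w hw ↦ hw
  have hg₀a : AnalyticAt ℂ g₀ c := (hg₀d.analyticOnNhd hslice) c h₀
  have hord : analyticOrderAt g₀ c = 1 := hg₀a.analyticOrderAt_eq_one_of_zero_deriv_ne_zero hG0 hG'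
  have hneG : ¬ g₀ =ᶠ[𝓝 c] 0 := by
    intro h
    rw [analyticOrderAt_eq_top.2 h] at hord
    exact ENat.top_ne_one hord
  obtain ⟨εG, rG, RG, hεG, hsubG, hWG, hzeroG, hrootsG⟩ := exists_weierstrassData hΩ hG h₀ hneG
  have hk₁ : analyticOrderNatAt g₀ c = 1 := by
    have : (analyticOrderNatAt g₀ c : ℕ∞) = 1 := by
      rw [Nat.cast_analyticOrderNatAt (by rw [hord]; exact ENat.top_ne_one.symm), hord]
    exact_mod_cast this
  rw [hk₁] at hrootsG
  -- the polydisc `Ω' = ball z₀ εG × ball c rG ⊆ Ω` and the Weierstrass data of `F` inside it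
  set Ω' : Set (E × ℂ) := ball z₀ εG ×ˢ ball c rG with hΩ'
  have hΩ'o : IsOpen Ω' := isOpen_ball.prod isOpen_ball
  have hΩ'Ω : Ω' ⊆ Ω := (Set.prod_mono Subset.rfl (ball_subset_ball hWG.lt.le)).trans hsubG
  have h₀' : (z₀, c) ∈ Ω' := mk_mem_prod (mem_ball_self hεG) (mem_ball_self hWG.pos)
  have hneF : ¬ (fun w ↦ F (z₀, w)) =ᶠ[𝓝 c] 0 := by
    intro h
    have hev : ∀ᶠ w in 𝓝[≠] c, F (z₀, w) = 0 ∧ w ∈ ball c rG :=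
      (h.and (isOpen_ball.mem_nhds (mem_ball_self hWG.pos))).filter_mono nhdsWithin_le_nhds
    obtain ⟨w, ⟨hw0, hwb⟩, hwc⟩ := (hev.and self_mem_nhdsWithin).exists
    have hGw : G (z₀, w) = 0 :=
      (hZ _ (hΩ'Ω (mk_mem_prod (mem_ball_self hεG) hwb))).1 hw0
    exact hzeroG w (ball_subset_closedBall hwb) hwc hGw
  obtain ⟨εF, rF, RF, hεF, hsubF, hWF, -, hrootsF⟩ :=
    exists_weierstrassData hΩ'o (hF.mono hΩ'Ω) h₀' hneF
  set k : ℕ := analyticOrderNatAt (fun w ↦ F (z₀, w)) c with hk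
  -- `ball z₀ εF ⊆ ball z₀ εG` and `ball c RF ⊆ ball c rG`
  have hprod := (prod_subset_prod_iff.1 hsubF)
  have hεε : ball z₀ εF ⊆ ball z₀ εG ∧ ball c RF ⊆ ball c rG := by
    rcases hprod with h | h | h
    · exact h
    · exact absurd h (nonempty_ball.2 hεF).ne_empty
    · exact absurd h (nonempty_ball.2 (hWF.pos.trans hWF.lt)).ne_empty
  -- for `z' ∈ ball z₀ εF`: one root `τ` of `G (z', ·)`, and `sliceRoots F = k • {τ}`
  have hroots : ∀ z' ∈ ball z₀ εF, ∃ τ : ℂ, sliceRoots G c rG z' = {τ} ∧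
      sliceRoots F c rF z' = Multiset.replicate k τ := by
    intro z' hz'
    have hz'G : z' ∈ ball z₀ εG := hεε.1 hz'
    have hcardG : (sliceRoots G c rG z').card = 1 := by
      rw [hWG.card_sliceRoots_eq (convex_ball z₀ εG).isPreconnected (mem_ball_self hεG) hz'G,
        hrootsG, Multiset.card_replicate]
    obtain ⟨τ, hτ⟩ := Multiset.card_eq_one.1 hcardG
    have hcardF : (sliceRoots F c rF z').card = k := by
      rw [hWF.card_sliceRoots_eq (convex_ball z₀ εF).isPreconnected (mem_ball_self hεF) hz',
        hrootsF, Multiset.card_replicate]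
    refine ⟨τ, hτ, Multiset.eq_replicate.2 ⟨hcardF, fun ρ hρ ↦ ?_⟩⟩
    have hρ' := (mem_rootMultiset_iff (hWF.differentiableOn_slice hz') hWF.pos hWF.lt
      (hWF.ne_zero z' hz')).1 hρ
    have hρG : G (z', ρ) = 0 := by
      refine (hZ _ (hΩ'Ω ?_)).1 hρ'.2
      exact hsubF (mk_mem_prod hz' (ball_subset_ball hWF.lt.le hρ'.1))
    have hmem : ρ ∈ sliceRoots G c rG z' :=
      (mem_rootMultiset_iff (hWG.differentiableOn_slice hz'G) hWG.pos hWG.lt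
        (hWG.ne_zero z' hz'G)).2 ⟨hεε.2 (ball_subset_ball hWF.lt.le hρ'.1), hρG⟩
    rw [hτ] at hmem
    exact Multiset.mem_singleton.1 hmem
  -- the factorisations
  have hcardGc : ∀ z' ∈ ball z₀ εG, (sliceRoots G c rG z').card = 1 := fun z' hz' ↦ by
    rw [hWG.card_sliceRoots_eq (convex_ball z₀ εG).isPreconnected (mem_ball_self hεG) hz',
      hrootsG, Multiset.card_replicate]
  have hcardFc : ∀ z' ∈ ball z₀ εF, (sliceRoots F c rF z').card = k := fun z' hz' ↦ by
    rw [hWF.card_sliceRoots_eq (convex_ball z₀ εF).isPreconnected (mem_ball_self hεF) hz',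
      hrootsF, Multiset.card_replicate]
  set U : Set (E × ℂ) := ball z₀ εF ×ˢ ball c rF with hU
  have hUΩ' : U ⊆ ball z₀ εG ×ˢ ball c rG :=
    Set.prod_mono hεε.1 ((ball_subset_ball hWF.lt.le).trans hεε.2)
  refine ⟨k, U, fun x ↦ weierstrassUnit F c rF x * (weierstrassUnit G c rG x ^ k)⁻¹,
    isOpen_ball.prod isOpen_ball, mk_mem_prod (mem_ball_self hεF) (mem_ball_self hWF.pos),
    hUΩ'.trans hΩ'Ω, ?_, fun x hx ↦ ?_, fun x hx ↦ ?_⟩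
  · have h1 : DifferentiableOn ℂ (weierstrassUnit F c rF) U := hWF.differentiableOn_weierstrassUnit hcardFc
    have h2 : DifferentiableOn ℂ (fun x ↦ weierstrassUnit G c rG x ^ k) U :=
      ((hWG.differentiableOn_weierstrassUnit hcardGc).mono hUΩ').pow k
    exact h1.mul (h2.inv fun x hx ↦ pow_ne_zero _ (hWG.eq_weierstrassFun_mul (hUΩ' hx)).2)
  · exact mul_ne_zero (hWF.eq_weierstrassFun_mul hx).2
      (inv_ne_zero (pow_ne_zero _ (hWG.eq_weierstrassFun_mul (hUΩ' hx)).2))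
  · obtain ⟨z', w⟩ := x
    obtain ⟨τ, hτG, hτF⟩ := hroots z' hx.1
    have hWFx : weierstrassFun F c rF (z', w) = (w - τ) ^ k :=
      weierstrassFun_eq_pow_of_eq_replicate hτF w
    have hWGx : weierstrassFun G c rG (z', w) = (w - τ) := by
      have h1 : sliceRoots G c rG z' = Multiset.replicate 1 τ := by rw [hτG]; rfl
      simpa using weierstrassFun_eq_pow_of_eq_replicate h1 w
    obtain ⟨hFx, -⟩ := hWF.eq_weierstrassFun_mul hx
    obtain ⟨hGx, huG⟩ := hWG.eq_weierstrassFun_mul (hUΩ' hx)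
    rw [hFx, hWFx, hGx, hWGx, mul_pow]
    field_simp

end SCV
end Literature.Analysis.Complex

/-! ### On a complex manifold -/

namespace Literature.Geometry.Kaehler

open Literature.Analysis.Complex.SCV

variable {E : Type*} [NormedAddCommGroup E] [NormedSpace ℂ E]
  {M : Type*} [TopologicalSpace M] [ChartedSpace E M]

/-- A function with non-zero differential at `m` takes non-zero values arbitrarily close to `m`
(otherwise it is locally zero and so is its differential). [folklore] -/
theorem frequently_ne_zero_of_mfderiv_ne_zero {w : M → ℂ} {m : M}
    (hdw : mfderiv 𝓘(ℂ, E) 𝓘(ℂ, ℂ) w m ≠ 0) : ∃ᶠ x in 𝓝 m, w x ≠ 0 := by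
  by_contra hcon
  rw [Filter.not_frequently] at hcon
  have h0 : w =ᶠ[𝓝 m] fun _ ↦ (0 : ℂ) := hcon.mono fun x hx ↦ by simpa using hx
  apply hdw
  rw [h0.mfderiv_eq]
  exact mfderiv_const

section NormalForm

variable [IsManifold 𝓘(ℂ, E) 1 M]

/-- **Local normal form of a holomorphic function along a smooth hypersurface.** On a complex
manifold let `h`, `w` be holomorphic near `m`, `w m = 0`, `dw(m) ≠ 0`, and `{h = 0} = {w = 0}`
near `m`. Then `h = w ^ k · v` near `m` for some `k : ℕ` and `v` holomorphic near `m` with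
`v m ≠ 0` (Griffiths–Harris, Ch. 1 §1: `g = f^a h` in `𝒪_p`; here at a smooth point of the
hypersurface, where the order `a` is read off the Weierstrass polynomial). In the chart at `m`,
along the affine plane `(z', t) ↦ e m + z' + t u` with `dw(u) ≠ 0`, this is
`exists_eq_pow_mul_of_forall_eq_zero_iff`. [cite: GriffithsHarrisPrinciples1978, Ch. 1 §1 (p. 130)]
[cite: Chirka1989, §1.1 Thm. (p. 3)] -/
theorem exists_eventuallyEq_pow_mul_of_mfderiv_ne_zero {h w : M → ℂ} {m : M}
    (hh : ∀ᶠ x in 𝓝 m, MDifferentiableAt 𝓘(ℂ, E) 𝓘(ℂ, ℂ) h x)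
    (hw : ∀ᶠ x in 𝓝 m, MDifferentiableAt 𝓘(ℂ, E) 𝓘(ℂ, ℂ) w x)
    (hw0 : w m = 0) (hdw : mfderiv 𝓘(ℂ, E) 𝓘(ℂ, ℂ) w m ≠ 0)
    (hZ : ∀ᶠ x in 𝓝 m, h x = 0 ↔ w x = 0) :
    ∃ (k : ℕ) (v : M → ℂ), (∀ᶠ x in 𝓝 m, MDifferentiableAt 𝓘(ℂ, E) 𝓘(ℂ, ℂ) v x) ∧ v m ≠ 0 ∧
      ∀ᶠ x in 𝓝 m, h x = w x ^ k * v x := by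
  set e := chartAt E m with he
  have hme : m ∈ e.source := mem_chart_source E m
  have hatlas : e ∈ atlas E M := chart_mem_atlas E m
  -- an open set `O ∋ m` inside the chart domain on which all hypotheses hold
  obtain ⟨O, hOsub, hOo, hmO⟩ : ∃ O ⊆ {x | x ∈ e.source ∧ MDifferentiableAt 𝓘(ℂ, E) 𝓘(ℂ, ℂ) h x ∧
      MDifferentiableAt 𝓘(ℂ, E) 𝓘(ℂ, ℂ) w x ∧ (h x = 0 ↔ w x = 0)}, IsOpen O ∧ m ∈ O :=
    _root_.mem_nhds_iff.1 (by
      filter_upwards [e.open_source.mem_nhds hme, hh, hw, hZ] with x h1 h2 h3 h4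
      exact ⟨h1, h2, h3, h4⟩)
  -- the chart expressions `h̃`, `w̃` on the open set `Õ = e(O)`
  set Õ : Set E := e.target ∩ e.symm ⁻¹' O with hÕ
  have hÕo : IsOpen Õ := e.isOpen_inter_preimage_symm hOo
  have hmÕ : e m ∈ Õ := ⟨e.map_source hme, by rw [mem_preimage, e.left_inv hme]; exact hmO⟩
  have hdiffAt : ∀ {f : M → ℂ} {y : E}, y ∈ Õ → MDifferentiableAt 𝓘(ℂ, E) 𝓘(ℂ, ℂ) f (e.symm y) →
      DifferentiableAt ℂ (f ∘ e.symm) y := fun {f y} hy hf ↦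
    mdifferentiableAt_iff_differentiableAt.1 (hf.comp y (mdifferentiableAt_atlas_symm hatlas hy.1))
  have hhc : DifferentiableOn ℂ (h ∘ e.symm) Õ := fun y hy ↦
    (hdiffAt hy (hOsub hy.2).2.1).differentiableWithinAt
  have hwc : DifferentiableOn ℂ (w ∘ e.symm) Õ := fun y hy ↦
    (hdiffAt hy (hOsub hy.2).2.2.1).differentiableWithinAt
  -- `d w̃ (e m) ≠ 0`
  have hwcat : DifferentiableAt ℂ (w ∘ e.symm) (e m) := hdiffAt hmÕ (by rw [e.left_inv hme]; exact (hOsub hmO).2.2.1)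
  have hd : fderiv ℂ (w ∘ e.symm) (e m) ≠ 0 := by
    intro h0
    apply hdw
    have heq : w =ᶠ[𝓝 m] (w ∘ e.symm) ∘ e := by
      filter_upwards [e.open_source.mem_nhds hme] with x hx
      simp only [Function.comp_apply, e.left_inv hx]
    rw [heq.mfderiv_eq, mfderiv_comp m (mdifferentiableAt_iff_differentiableAt.2 hwcat)
      (mdifferentiableAt_atlas hatlas hme), mfderiv_eq_fderiv, h0]
    ext v
    rfl
  obtain ⟨u, hu⟩ : ∃ u : E, fderiv ℂ (w ∘ e.symm) (e m) u ≠ 0 := by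
    by_contra hcon
    push Not at hcon
    exact hd (ContinuousLinearMap.ext hcon)
  -- the affine plane `A (z', t) = e m + z' + t • u` and the functions `F`, `G` on `Ω = A⁻¹(Õ)`
  set A : E × ℂ → E := fun p ↦ e m + p.1 + p.2 • u with hA
  have hAd : Differentiable ℂ A := by fun_prop
  set Ω : Set (E × ℂ) := A ⁻¹' Õ with hΩ
  have hΩo : IsOpen Ω := hÕo.preimage hAd.continuous
  have hA0 : A (0, 0) = e m := by simp [hA]
  have h0Ω : ((0 : E), (0 : ℂ)) ∈ Ω := by rw [hΩ, mem_preimage, hA0]; exact hmÕ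
  have hF : DifferentiableOn ℂ ((h ∘ e.symm) ∘ A) Ω := hhc.comp hAd.differentiableOn (mapsTo_preimage A Õ)
  have hG : DifferentiableOn ℂ ((w ∘ e.symm) ∘ A) Ω := hwc.comp hAd.differentiableOn (mapsTo_preimage A Õ)
  have hG0 : ((w ∘ e.symm) ∘ A) (0, 0) = 0 := by
    simp only [Function.comp_apply, hA0, e.left_inv hme, hw0]
  have hG' : deriv (fun t ↦ ((w ∘ e.symm) ∘ A) (0, t)) 0 ≠ 0 := by
    have hline : HasDerivAt (fun t : ℂ ↦ e m + t • u) u 0 := by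
      simpa using ((hasDerivAt_id (0 : ℂ)).smul_const u).const_add (e m)
    have hcomp : HasDerivAt (fun t : ℂ ↦ (w ∘ e.symm) (e m + t • u))
        (fderiv ℂ (w ∘ e.symm) (e m) u) 0 := by
      have h2 : HasFDerivAt (w ∘ e.symm) (fderiv ℂ (w ∘ e.symm) (e m)) (e m + (0 : ℂ) • u) := by
        rw [zero_smul, add_zero]; exact hwcat.hasFDerivAt
      exact h2.comp_hasDerivAt (0 : ℂ) hline
    have hfun : (fun t ↦ ((w ∘ e.symm) ∘ A) (0, t)) = fun t ↦ (w ∘ e.symm) (e m + t • u) := by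
      funext t; simp [hA]
    rw [hfun, hcomp.deriv]
    exact hu
  have hZ' : ∀ p ∈ Ω, ((h ∘ e.symm) ∘ A) p = 0 ↔ ((w ∘ e.symm) ∘ A) p = 0 := fun p hp ↦
    (hOsub hp.2).2.2.2
  obtain ⟨k, U, u', hUo, h0U, -, hu'd, hu'0, hFG⟩ :=
    exists_eq_pow_mul_of_forall_eq_zero_iff hΩo hF hG h0Ω hG0 hG' hZ'
  -- back on `M`: `v x = u' (e x - e m, 0)`
  have hψ : ContinuousAt (fun x : M ↦ ((e x - e m, (0 : ℂ)) : E × ℂ)) m :=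
    (((e.continuousAt hme).sub continuousAt_const).prodMk continuousAt_const)
  have hψ0 : ((e m - e m, (0 : ℂ)) : E × ℂ) = (0, 0) := by simp
  have hev : ∀ᶠ x in 𝓝 m, x ∈ e.source ∧ ((e x - e m, (0 : ℂ)) : E × ℂ) ∈ U := by
    filter_upwards [e.open_source.mem_nhds hme,
      hψ.preimage_mem_nhds (by rw [hψ0]; exact hUo.mem_nhds h0U)] with x hx hxU
    exact ⟨hx, hxU⟩
  have hAψ : ∀ x, A (e x - e m, 0) = e x := fun x ↦ by simp [hA]
  refine ⟨k, fun x ↦ u' (e x - e m, 0), ?_, by show u' (e m - e m, 0) ≠ 0; rw [sub_self]; exact hu'0 _ h0U, ?_⟩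
  · filter_upwards [hev] with x ⟨hx, hxU⟩
    have hd' : DifferentiableAt ℂ (fun y : E ↦ u' (y - e m, 0)) (e x) := by
      have h1 : DifferentiableAt ℂ u' ((e x - e m, (0 : ℂ)) : E × ℂ) :=
        hu'd.differentiableAt (hUo.mem_nhds hxU)
      exact h1.comp (e x) (by fun_prop)
    exact (mdifferentiableAt_iff_differentiableAt.2 hd').comp x (mdifferentiableAt_atlas hatlas hx)
  · filter_upwards [hev] with x ⟨hx, hxU⟩
    have := hFG _ hxU
    simp only [Function.comp_apply, hAψ, e.left_inv hx] at this
    exact this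

end NormalForm

/-! ### The order along a hypersurface -/

/-- **The order of `h` along the hypersurface `{w = 0}` at `m`**: the largest `k` such that
`h = w ^ k · v` near `m` for some `v` continuous at `m` (Griffiths–Harris, Ch. 1 §1: "the largest
integer `a` such that `g = f^a · h`"; junk `0`/`sSup` when no such largest `k` exists).
[cite: GriffithsHarrisPrinciples1978, Ch. 1 §1 (p. 130)] -/
def orderAlong (h w : M → ℂ) (m : M) : ℕ :=
  sSup {k : ℕ | ∃ v : M → ℂ, ContinuousAt v m ∧ ∀ᶠ x in 𝓝 m, h x = w x ^ k * v x}

/-- **A normal form computes the order** (uniqueness of the exponent): if `h = w ^ e · v` near `m`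
with `v` continuous at `m`, `v m ≠ 0`, `w m = 0`, and `w` takes non-zero values arbitrarily close to
`m`, then `orderAlong h w m = e`. Indeed `h = w ^ k · v'` with `k > e` would give `v = w ^ {k-e} v'`
off `{w = 0}`, whence `v m = 0` by continuity. In particular the order does not change when `h` and
`w` are multiplied by functions continuous and non-zero at `m`, and it is locally constant along the
smooth part of the hypersurface (Griffiths–Harris: "`ord_{V,p}` is independent of `p`").
[cite: GriffithsHarrisPrinciples1978, Ch. 1 §1 (pp. 130–131)] -/
theorem orderAlong_eq_of_eventuallyEq {h w v : M → ℂ} {m : M} {e : ℕ}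
    (hw : ContinuousAt w m) (hw0 : w m = 0) (hv : ContinuousAt v m) (hvm : v m ≠ 0)
    (heq : ∀ᶠ x in 𝓝 m, h x = w x ^ e * v x) (hfr : ∃ᶠ x in 𝓝 m, w x ≠ 0) :
    orderAlong h w m = e := by
  have hS : {k : ℕ | ∃ v : M → ℂ, ContinuousAt v m ∧ ∀ᶠ x in 𝓝 m, h x = w x ^ k * v x} = Iic e := by
    ext k
    simp only [mem_setOf_eq, mem_Iic]
    constructor
    · rintro ⟨v', hv', heq'⟩
      by_contra hlt
      push Not at hlt
      haveI : (𝓝[{x | w x ≠ 0}] m).NeBot := frequently_iff_neBot.1 hfr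
      have hev : v =ᶠ[𝓝[{x | w x ≠ 0}] m] fun x ↦ w x ^ (k - e) * v' x := by
        rw [Filter.EventuallyEq, eventually_nhdsWithin_iff]
        filter_upwards [heq, heq'] with x h1 h2 hx
        have h3 : w x ^ e * v x = w x ^ e * (w x ^ (k - e) * v' x) := by
          rw [← h1, h2, ← mul_assoc, ← pow_add, Nat.add_sub_cancel' hlt.le]
        exact mul_left_cancel₀ (pow_ne_zero e hx) h3
      have ht₁ : Tendsto v (𝓝[{x | w x ≠ 0}] m) (𝓝 (v m)) := hv.tendsto.mono_left nhdsWithin_le_nhds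
      have ht₂ : Tendsto (fun x ↦ w x ^ (k - e) * v' x) (𝓝[{x | w x ≠ 0}] m)
          (𝓝 (w m ^ (k - e) * v' m)) :=
        ((hw.pow _).mul hv').tendsto.mono_left nhdsWithin_le_nhds
      have hlim := tendsto_nhds_unique (ht₁.congr' hev) ht₂
      rw [hw0, zero_pow (Nat.sub_ne_zero_of_lt hlt), zero_mul] at hlim
      exact hvm hlim
    · intro hk
      refine ⟨fun x ↦ w x ^ (e - k) * v x, (hw.pow _).mul hv, ?_⟩
      filter_upwards [heq] with x hx
      rw [hx, ← mul_assoc, ← pow_add, Nat.add_sub_cancel' hk]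
  show sSup _ = e
  rw [hS, csSup_Iic]

/-! ### Hypersurfaces have codimension one at their regular points -/

/-- A regular point of codimension `0` of `Z` is an interior point of `Z`. [folklore] -/
theorem IsRegularPointOfCodim.eventually_mem_of_zero {Z : Set M} {z : M}
    (h : IsRegularPointOfCodim 𝓘(ℂ, E) Z 0 z) : ∀ᶠ x in 𝓝 z, x ∈ Z := by
  obtain ⟨U, hU, hzU, f, -, hZU, -⟩ := h
  filter_upwards [hU.mem_nhds hzU] with x hx
  have : x ∈ U ∩ f ⁻¹' {0} := ⟨hx, by simp [Subsingleton.elim (f x) 0]⟩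
  rw [← hZU] at this
  exact this.1

/-- **A hypersurface has codimension at most one at each of its regular points.** Let `h` be
holomorphic on the open `U` and `Z ∩ U = {h = 0} ∩ U`. If `z ∈ Z ∩ U` is a regular point of
codimension `c` of `Z`, then `c ≤ 1`: were `c ≥ 2`, the function `1/h`, holomorphic off `Z` near `z`,
would extend holomorphically across the submanifold `Z` of codimension `≥ 2` (second Riemann
extension theorem, the tree's `SCV.exists_nhds_differentiableOn_eqOn_of_isRegPt`), forcing
`h z ≠ 0`. [cite: FritzscheGrauert2002, Ch. III Thm. 6.12] [cite: GriffithsHarrisPrinciples1978, Ch. 0 §2] -/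
theorem codim_le_one_of_isRegularPointOfCodim_of_eq_setOf [FiniteDimensional ℂ E]
    [IsManifold 𝓘(ℂ, E) 1 M] {U : Set M} (hU : IsOpen U) {h : M → ℂ}
    (hh : MDifferentiableOn 𝓘(ℂ, E) 𝓘(ℂ, ℂ) h U) {Z : Set M} (hZU : Z ∩ U = {x ∈ U | h x = 0})
    {z : M} (hzU : z ∈ U) (hz : z ∈ Z) {c : ℕ} (hreg : IsRegularPointOfCodim 𝓘(ℂ, E) Z c z) :
    c ≤ 1 := by
  by_contra hlt
  have hc : 2 ≤ c := by omega
  set φ := extChartAt 𝓘(ℂ, E) z with hφ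
  set B : Set E := chartImage 𝓘(ℂ, E) z Z with hB
  have hzs : z ∈ φ.source := mem_extChartAt_source z
  have hreg' : SCV.IsRegPt B c (φ z) := hreg.isRegPt_chartImage hzs
  set Ũ : Set E := φ.target ∩ φ.symm ⁻¹' U with hŨ
  have hŨo : IsOpen Ũ := isOpen_extChartAt_target_inter_preimage_symm z hU
  have haŨ : φ z ∈ Ũ := ⟨mem_extChartAt_target z, by
    rw [mem_preimage, extChartAt_to_inv]; exact hzU⟩
  have haB : φ z ∈ B := ⟨mem_extChartAt_target z, by
    rw [mem_preimage, extChartAt_to_inv]; exact hz⟩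
  have hhc : DifferentiableOn ℂ (h ∘ φ.symm) Ũ := MDifferentiableOn.differentiableOn_extChartAt_symm hh z
  have hzero : ∀ y ∈ Ũ, (h ∘ φ.symm) y = 0 ↔ y ∈ B := by
    intro y hy
    have hyU : φ.symm y ∈ U := hy.2
    constructor
    · intro h0
      have : φ.symm y ∈ Z ∩ U := by rw [hZU]; exact ⟨hyU, h0⟩
      exact ⟨hy.1, this.1⟩
    · intro hyB
      have : φ.symm y ∈ Z ∩ U := ⟨hyB.2, hyU⟩
      rw [hZU] at this
      exact this.2
  have hf : DifferentiableOn ℂ (fun y ↦ ((h ∘ φ.symm) y)⁻¹) (Ũ \ B) :=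
    (hhc.mono fun y hy ↦ hy.1).inv fun y hy h0 ↦ hy.2 ((hzero y hy.1).1 h0)
  obtain ⟨V, hVo, haV, hVŨ, g, hg, hgf⟩ :=
    SCV.exists_nhds_differentiableOn_eqOn_of_isRegPt hŨo haŨ haB hreg' hc hf
  -- points off `B` accumulate at `φ z`
  have hfr : ∃ᶠ y in 𝓝 (φ z), y ∉ B := by
    obtain ⟨U₀, hU₀, haU₀, g₀, hg₀, hBU₀, hsurj⟩ := hreg'
    by_contra hcon
    rw [Filter.not_frequently] at hcon
    simp only [not_not] at hcon
    have h0 : g₀ =ᶠ[𝓝 (φ z)] fun _ ↦ 0 := by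
      filter_upwards [hcon, hU₀.mem_nhds haU₀] with y hyB hyU
      exact (hBU₀.subset ⟨hyB, hyU⟩).2
    have hd0 : fderiv ℂ g₀ (φ z) = 0 := by rw [h0.fderiv_eq]; exact fderiv_const_apply 0
    obtain ⟨v, hv⟩ := hsurj (fun _ ↦ 1)
    rw [hd0] at hv
    have := congrFun hv ⟨0, by omega⟩
    simp at this
  have hfreq : ∃ᶠ y in 𝓝 (φ z), g y * (h ∘ φ.symm) y = 1 := by
    refine (hfr.and_eventually (hVo.mem_nhds haV)).mono fun y ⟨hyB, hyV⟩ ↦ ?_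
    have hne : (h ∘ φ.symm) y ≠ 0 := fun h0 ↦ hyB ((hzero y (hVŨ hyV)).1 h0)
    rw [hgf ⟨hyV, hyB⟩, inv_mul_cancel₀ hne]
  have hcont : ContinuousAt (fun y ↦ g y * (h ∘ φ.symm) y) (φ z) :=
    (hg.continuousOn.continuousAt (hVo.mem_nhds haV)).mul
      (hhc.continuousOn.continuousAt (hŨo.mem_nhds haŨ))
  have hone : g (φ z) * (h ∘ φ.symm) (φ z) = 1 :=
    tendsto_nhds_unique_of_frequently_eq hcont.tendsto tendsto_const_nhds hfreq
  have hhz : (h ∘ φ.symm) (φ z) = 0 := (hzero _ haŨ).2 haB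
  rw [hhz, mul_zero] at hone
  exact zero_ne_one hone

end Literature.Geometry.Kaehler

end
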